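import Summits.CriticalPhenomena.PercolationContinuityZ3.Theorems.Transplant.PlanarSkeletonSignDefs
import HarnessLib

/-!
# The pyrochlore (corner-sharing tetrahedra) net in integer coordinates: its chart `(p₀ + p₁, p₀ − p₁)` is SIGN-COMPLETE (`−I` and both axis flips
# through EVERY vertex are automorphisms), 2-Lipschitz, translated by the fcc frames (four types), and every outward step `±2e_i` is a single edge or a
# 2-PATH — kernel placement certificate at scale `N = 2` (no node)

builds on p205010 (kernel theorem, internal audit signed; external expert review pending) — nothing in this file uses p205010; NOTHING is claimed about
`θ_{pyrochlore}(p_c)` nor about any node.  Lane `prim-bschramm`, seat `prim-bschramm-p4` (gen 20; PART C3, `HOME/bschramm/P4-GENERAL.md` §42.4).  Helper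
file (`--supports stmt-CriticalPhenomena-4575 --as helper`); companion of `NboSignQuasiChart` (same method, scale `2` instead of `1`).

THE NET.  Pyrochlore-bond = the bond midpoints of diamond = corner-sharing tetrahedra.  Integer model (halved doubled midpoints): `p ∈ ℤ³` is a site iff
EITHER all three coordinates are even and `p₀+p₁+p₂ ≡ 0 (mod 4)` OR exactly two are odd and `p₀+p₁+p₂ ≡ 2 (mod 4)`; bonds = the twelve vectors
`(±1,±1,0), (±1,0,±1), (0,±1,±1)` between sites (each site has exactly six such neighbours — the two tetrahedra through it; checked numerically in the seat,
`HOME/prim-bschramm-p4-g20/lean/pyro_model.py`, together with everything below).  (The graph is declared on all of `ℤ³`; non-sites are isolated.)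
THE CERTIFICATE.  Chart `chart p = (p₀ + p₁, p₀ − p₁)`: every bond moves it by one of `(±2,0), (0,±2), (±1,±1)` — sup-norm `≤ 2` (`lip`); the INVERSION
`q ↦ 2c − q` through any lattice point of even coordinate sum (in particular through every site) is an automorphism acting by `−I` (`invIso`, `exists_neg`);
the diagonal mirror `(q₀,q₁,q₂) ↦ (q₁+k, q₀−k, q₂)`, `k` even, acts by `flipSnd` at the points with `c₀ − c₁ = k`, and `(q₀,q₁,q₂) ↦ (m−q₁, m−q₀, q₂)`, `m` odd,
by `flipFst` at the points with `c₀ + c₁ = m` (`swapIso`, `aswapIso`); since `c₀ − c₁` and `c₀ + c₁` have the same parity, EVERY lattice point carries `−I`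
and an axis flip, hence the whole axis Klein group (`exists_flipSnd`, `exists_flipFst`).  Frames: translations by `w ≡ 0 (mod 2)` with `Σw ≡ 0 (mod 4)`
(the fcc lattice), four base vertices `0, (0,1,1), (1,0,1), (1,1,0)` (`shiftIso`, `exists_frame`).  Steps: at every site each of `±2e₀, ±2e₁` is a single
bond or a 2-path (16 explicit base cases, `qstep_base`, transported by the frames, `qstep`).  So pyrochlore-bond waits for exactly the SCALED (`N = 2`)
quasi-step re-run of the CLOSED `(ℤ/2)²` node — symmetry is not its problem (g19 had placed it under the open multi-type `{±1}` node for the unit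
hexagonal chart; at scale 2 the axis flips exist).  (κ) is not typed here.
[cite: ConwaySloane1999, Ch. 4 §6.1 (diamond and its bond structure)] [cite: KozmaNitzan2024, §4 p. 15 (outward steps), p. 16 (Lemma 8)]
-/

noncomputable section

namespace Summit.CriticalPhenomena.PercolationContinuityZ3.Theorems.Transplant

open SimpleGraph Literature.Probability.LatticeModels Literature.Probability.Percolation
open scoped Classical

namespace PyroZ3

/-! ## §1 Sites, bonds, the graph -/

/-- The site set of pyrochlore (halved doubled bond midpoints of diamond). [cite: ConwaySloane1999, Ch. 4 §6.1] -/
def sites : Set (Site 3) :=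
  {p | (p 0 % 2 = 0 ∧ p 1 % 2 = 0 ∧ p 2 % 2 = 0 ∧ (p 0 + p 1 + p 2) % 4 = 0) ∨
       (p 0 % 2 + p 1 % 2 + p 2 % 2 = 2 ∧ (p 0 + p 1 + p 2) % 4 = 2)}

/-- Membership in `sites` is decidable. [folklore] -/
instance sites_decidable (p : Site 3) : Decidable (p ∈ sites) :=
  inferInstanceAs (Decidable ((p 0 % 2 = 0 ∧ p 1 % 2 = 0 ∧ p 2 % 2 = 0 ∧ (p 0 + p 1 + p 2) % 4 = 0) ∨
    (p 0 % 2 + p 1 % 2 + p 2 % 2 = 2 ∧ (p 0 + p 1 + p 2) % 4 = 2)))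

/-- The twelve bond vectors `(±1,±1,0), (±1,0,±1), (0,±1,±1)`. [folklore] -/
def V12 : Finset (Site 3) :=
  {![1, 1, 0], ![1, -1, 0], ![-1, 1, 0], ![-1, -1, 0], ![1, 0, 1], ![1, 0, -1], ![-1, 0, 1], ![-1, 0, -1],
   ![0, 1, 1], ![0, 1, -1], ![0, -1, 1], ![0, -1, -1]}

/-- Membership in `V12`: entries in `{−1,0,1}` with `ℓ¹`-norm two. [folklore] -/
theorem mem_V12_iff (v : Site 3) : v ∈ V12 ↔ |v 0| ≤ 1 ∧ |v 1| ≤ 1 ∧ |v 2| ≤ 1 ∧ |v 0| + |v 1| + |v 2| = 2 := by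
  constructor
  · intro h
    simp only [V12, Finset.mem_insert, Finset.mem_singleton] at h
    rcases h with rfl | rfl | rfl | rfl | rfl | rfl | rfl | rfl | rfl | rfl | rfl | rfl <;> simp
  · rintro ⟨b0, b1, b2, h⟩
    have e : v = ![v 0, v 1, v 2] := by funext i; fin_cases i <;> rfl
    have a0 := le_abs_self (v 0); have c0 := neg_abs_le (v 0)
    have a1 := le_abs_self (v 1); have c1 := neg_abs_le (v 1)
    have a2 := le_abs_self (v 2); have c2 := neg_abs_le (v 2)
    have h0 : v 0 = 0 ∨ v 0 = 1 ∨ v 0 = -1 := by omega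
    have h1 : v 1 = 0 ∨ v 1 = 1 ∨ v 1 = -1 := by omega
    have h2 : v 2 = 0 ∨ v 2 = 1 ∨ v 2 = -1 := by omega
    rw [e]
    rcases h0 with h0 | h0 | h0 <;> rcases h1 with h1 | h1 | h1 <;> rcases h2 with h2 | h2 | h2 <;>
      simp only [h0, h1, h2, abs_zero, abs_one, abs_neg] at h ⊢ <;> first | decide | omega

/-- `V12` is invariant under negation. [folklore] -/
theorem neg_mem_V12 {v : Site 3} (h : v ∈ V12) : -v ∈ V12 := by
  rw [mem_V12_iff] at h ⊢; simpa using h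

/-- `0 ∉ V12`. [folklore] -/
theorem zero_notMem_V12 : (0 : Site 3) ∉ V12 := by decide

/-- **The pyrochlore net** (geometric model; non-sites are isolated vertices of the ambient `ℤ³`). [cite: ConwaySloane1999, Ch. 4 §6.1] -/
def graph : SimpleGraph (Site 3) := SimpleGraph.fromRel fun x y => x ∈ sites ∧ y ∈ sites ∧ y - x ∈ V12

/-- Adjacency. [folklore] -/
theorem adj_iff (x y : Site 3) : graph.Adj x y ↔ x ∈ sites ∧ y ∈ sites ∧ y - x ∈ V12 := by
  rw [graph, SimpleGraph.fromRel_adj]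
  constructor
  · rintro ⟨-, h | ⟨hy, hx, h⟩⟩
    · exact h
    · exact ⟨hx, hy, by rw [← neg_sub]; exact neg_mem_V12 h⟩
  · intro h
    refine ⟨fun hxy => zero_notMem_V12 ?_, Or.inl h⟩
    subst hxy; simpa using h.2.2

/-- The neighbours of `x` are among the `x + v`, `v ∈ V12`. [folklore] -/
theorem neighborSet_subset (x : Site 3) : graph.neighborSet x ⊆ ↑(V12.image (x + ·)) := by
  intro y hy
  rw [SimpleGraph.mem_neighborSet, adj_iff] at hy
  rw [Finset.coe_image]
  exact ⟨y - x, Finset.mem_coe.2 hy.2.2, by abel⟩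

/-- The pyrochlore net is locally finite. [folklore] -/
noncomputable instance graph_locallyFinite : graph.LocallyFinite := fun x =>
  ((Finset.finite_toSet _).subset (neighborSet_subset x)).fintype

/-- Concrete adjacency from the three decidable facts. [folklore] -/
theorem adj_of (x y : Site 3) (hx : x ∈ sites) (hy : y ∈ sites) (h : y - x ∈ V12) : graph.Adj x y := (adj_iff x y).2 ⟨hx, hy, h⟩

/-! ## §2 Automorphisms: inversions, the two diagonal mirrors, fcc translations; frames -/

/-- The inversion `q ↦ 2c − q` through the lattice point `c`. [folklore] -/
def inv (c : Site 3) (q : Site 3) : Site 3 := fun i => 2 * c i - q i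

/-- Inversions through points of even coordinate sum preserve the site set. [folklore] -/
theorem mem_sites_inv {c : Site 3} (hc : (c 0 + c 1 + c 2) % 2 = 0) (q : Site 3) : inv c q ∈ sites ↔ q ∈ sites := by
  simp only [sites, Set.mem_setOf_eq, inv]; omega

/-- **Inversion through a point of even coordinate sum is an automorphism.** [cite: KozmaNitzan2024, §4 p. 16 (Lemma 8)] -/
def invIso (c : Site 3) (hc : (c 0 + c 1 + c 2) % 2 = 0) : graph ≃g graph where
  toFun := inv c
  invFun := inv c
  left_inv q := by funext i; simp [inv]
  right_inv q := by funext i; simp [inv]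
  map_rel_iff' := by
    intro x y
    have e : inv c y - inv c x = -(y - x) := by funext i; simp [inv]
    simp only [Equiv.coe_fn_mk, adj_iff, mem_sites_inv hc, e]
    exact ⟨fun ⟨hx, hy, h⟩ => ⟨hx, hy, by simpa using neg_mem_V12 h⟩, fun ⟨hx, hy, h⟩ => ⟨hx, hy, neg_mem_V12 h⟩⟩

/-- The diagonal mirror `(q₀,q₁,q₂) ↦ (q₁ + k, q₀ − k, q₂)` (plane `q₀ − q₁ = k`). [folklore] -/
def swap (k : ℤ) (q : Site 3) : Site 3 := ![q 1 + k, q 0 - k, q 2]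

/-- The anti-diagonal mirror `(q₀,q₁,q₂) ↦ (m − q₁, m − q₀, q₂)` (plane `q₀ + q₁ = m`). [folklore] -/
def aswap (m : ℤ) (q : Site 3) : Site 3 := ![m - q 1, m - q 0, q 2]

/-- `swap k`, `k` even, preserves the site set. [folklore] -/
theorem mem_sites_swap {k : ℤ} (hk : k % 2 = 0) (q : Site 3) : swap k q ∈ sites ↔ q ∈ sites := by
  simp only [sites, Set.mem_setOf_eq, swap, Matrix.cons_val_zero, Matrix.cons_val_one, Matrix.cons_val_two, Matrix.head_cons,
    Matrix.tail_cons]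
  omega

/-- `aswap m`, `m` odd, preserves the site set. [folklore] -/
theorem mem_sites_aswap {m : ℤ} (hm : m % 2 = 1) (q : Site 3) : aswap m q ∈ sites ↔ q ∈ sites := by
  simp only [sites, Set.mem_setOf_eq, aswap, Matrix.cons_val_zero, Matrix.cons_val_one, Matrix.cons_val_two, Matrix.head_cons,
    Matrix.tail_cons]
  omega

/-- Coordinate permutations/sign changes of the first two entries preserve `V12`. [folklore] -/
theorem swapVec_mem_V12_iff (v : Site 3) : (![v 1, v 0, v 2] : Site 3) ∈ V12 ↔ v ∈ V12 := by
  rw [mem_V12_iff, mem_V12_iff]; simp only [Matrix.cons_val_zero, Matrix.cons_val_one, Matrix.cons_val_two, Matrix.head_cons,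
    Matrix.tail_cons]; omega

/-- The same for `(−v₁, −v₀, v₂)`. [folklore] -/
theorem aswapVec_mem_V12_iff (v : Site 3) : (![-v 1, -v 0, v 2] : Site 3) ∈ V12 ↔ v ∈ V12 := by
  rw [mem_V12_iff, mem_V12_iff]; simp only [Matrix.cons_val_zero, Matrix.cons_val_one, Matrix.cons_val_two, Matrix.head_cons,
    Matrix.tail_cons, abs_neg]; omega

/-- **The diagonal mirror through a plane `q₀ − q₁ = k`, `k` even, is an automorphism.** [cite: KozmaNitzan2024, §4 p. 16 (Lemma 8)] -/
def swapIso (k : ℤ) (hk : k % 2 = 0) : graph ≃g graph where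
  toFun := swap k
  invFun := swap k
  left_inv q := by funext i; fin_cases i <;> simp [swap]
  right_inv q := by funext i; fin_cases i <;> simp [swap]
  map_rel_iff' := by
    intro x y
    have e : swap k y - swap k x = ![(y - x) 1, (y - x) 0, (y - x) 2] := by
      funext i; fin_cases i <;> simp [swap]
    simp only [Equiv.coe_fn_mk, adj_iff, mem_sites_swap hk, e, swapVec_mem_V12_iff]

/-- **The anti-diagonal mirror through a plane `q₀ + q₁ = m`, `m` odd, is an automorphism.** [cite: KozmaNitzan2024, §4 p. 16 (Lemma 8)] -/
def aswapIso (m : ℤ) (hm : m % 2 = 1) : graph ≃g graph where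
  toFun := aswap m
  invFun := aswap m
  left_inv q := by funext i; fin_cases i <;> simp [aswap]
  right_inv q := by funext i; fin_cases i <;> simp [aswap]
  map_rel_iff' := by
    intro x y
    have e : aswap m y - aswap m x = ![-(y - x) 1, -(y - x) 0, (y - x) 2] := by
      funext i; fin_cases i <;> simp [aswap]
    simp only [Equiv.coe_fn_mk, adj_iff, mem_sites_aswap hm, e, aswapVec_mem_V12_iff]

/-- The fcc frame vectors: even coordinates with sum `≡ 0 (mod 4)`. [folklore] -/
def frameVecs : Set (Site 3) := {w | w 0 % 2 = 0 ∧ w 1 % 2 = 0 ∧ w 2 % 2 = 0 ∧ (w 0 + w 1 + w 2) % 4 = 0}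

/-- Translation by a frame vector preserves the site set. [folklore] -/
theorem mem_sites_add {w : Site 3} (hw : w ∈ frameVecs) (q : Site 3) : q + w ∈ sites ↔ q ∈ sites := by
  obtain ⟨h0, h1, h2, hs⟩ := hw
  simp only [sites, Set.mem_setOf_eq, Pi.add_apply]; omega

/-- **Translation by a frame vector is an automorphism.** [folklore] -/
def shiftIso (w : Site 3) (hw : w ∈ frameVecs) : graph ≃g graph where
  toEquiv := Equiv.addRight w
  map_rel_iff' := by
    intro x y
    simp only [Equiv.coe_addRight, adj_iff, mem_sites_add hw, add_sub_add_right_eq_sub]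

/-- `shiftIso w _ x = x + w`. [folklore] -/
@[simp] theorem shiftIso_apply (w : Site 3) (hw : w ∈ frameVecs) (x : Site 3) : shiftIso w hw x = x + w := rfl

/-- The four base vertices `0, (0,1,1), (1,0,1), (1,1,0)`. [folklore] -/
def base : Fin 4 → Site 3 := ![![0, 0, 0], ![0, 1, 1], ![1, 0, 1], ![1, 1, 0]]

/-- The base vertices are sites. [folklore] -/
theorem base_mem_sites : ∀ c : Fin 4, base c ∈ sites := by decide

/-- **Frames: every site is an fcc translate of one of the four base vertices.** [cite: KozmaNitzan2024, §4 p. 16 (Lemma 8)] -/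
theorem exists_frame (x : Site 3) (hx : x ∈ sites) : ∃ (c : Fin 4) (w : Site 3) (hw : w ∈ frameVecs), shiftIso w hw (base c) = x := by
  simp only [sites, Set.mem_setOf_eq] at hx
  rcases hx with ⟨h0, h1, h2, hs⟩ | ⟨hpar, hs⟩
  · exact ⟨0, x - base 0, by refine ⟨?_, ?_, ?_, ?_⟩ <;> simp [base] <;> omega, by simp⟩
  · have e0 := Int.emod_two_eq_zero_or_one (x 0)
    have e1 := Int.emod_two_eq_zero_or_one (x 1)
    have e2 := Int.emod_two_eq_zero_or_one (x 2)
    rcases e0 with e0 | e0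
    · exact ⟨1, x - base 1, by refine ⟨?_, ?_, ?_, ?_⟩ <;> simp [base] <;> omega, by simp⟩
    · rcases e1 with e1 | e1
      · exact ⟨2, x - base 2, by refine ⟨?_, ?_, ?_, ?_⟩ <;> simp [base] <;> omega, by simp⟩
      · exact ⟨3, x - base 3, by refine ⟨?_, ?_, ?_, ?_⟩ <;> simp [base] <;> omega, by simp⟩

/-! ## §3 The chart `(p₀ + p₁, p₀ − p₁)`: 2-Lipschitz, the full axis point group at every lattice point -/

/-- The chart `p ↦ (p₀ + p₁, p₀ − p₁)`. [cite: KozmaNitzan2024, §4 p. 15 (the coordinate map)] -/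
def chart (p : Site 3) : Site 2 := ![p 0 + p 1, p 0 - p 1]

/-- `chart` is additive. [folklore] -/
theorem chart_add (x u : Site 3) : chart (x + u) = chart x + chart u := by
  funext j; fin_cases j <;> simp [chart] <;> ring

/-- **The chart is 2-Lipschitz in the sup-norm along bonds** (bond steps `(±2,0), (0,±2), (±1,±1)`). [cite: KozmaNitzan2024, §4 p. 15] -/
theorem lip {x y : Site 3} (h : graph.Adj x y) (j : Fin 2) : |chart x j - chart y j| ≤ 2 := by
  have hv := (mem_V12_iff _).1 ((adj_iff x y).1 h).2.2
  simp only [Pi.sub_apply] at hv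
  obtain ⟨b0, b1, -, -⟩ := hv
  rw [abs_le] at b0 b1
  fin_cases j
  · show |x 0 + x 1 - (y 0 + y 1)| ≤ 2
    rw [abs_le]; constructor <;> omega
  · show |x 0 - x 1 - (y 0 - y 1)| ≤ 2
    rw [abs_le]; constructor <;> omega

/-- **`−I` at every point of even coordinate sum** (in particular at every site). [cite: KozmaNitzan2024, §4 p. 16 (Lemma 8)] -/
theorem exists_neg (c : Site 3) (hc : (c 0 + c 1 + c 2) % 2 = 0) :
    ∃ α : graph ≃g graph, α c = c ∧ ∀ w, chart (α w) - chart c = -(chart w - chart c) := by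
  refine ⟨invIso c hc, by funext i; show 2 * c i - c i = c i; ring, fun w => ?_⟩
  show chart (inv c w) - chart c = -(chart w - chart c)
  funext j; fin_cases j <;> simp [chart, inv] <;> ring

/-- **`flipSnd` at every lattice point**: the diagonal mirror when `c₀ − c₁` is even, else the anti-diagonal mirror composed with the inversion.
[cite: KozmaNitzan2024, §4 p. 16 (Lemma 8)] -/
theorem exists_flipSnd (c : Site 3) (hc : (c 0 + c 1 + c 2) % 2 = 0) :
    ∃ α : graph ≃g graph, α c = c ∧ ∀ w, chart (α w) - chart c = flipSnd (chart w - chart c) := by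
  rcases Int.emod_two_eq_zero_or_one (c 0 - c 1) with hk | hk
  · refine ⟨swapIso (c 0 - c 1) hk, by funext i; fin_cases i <;> simp [swapIso, swap], fun w => ?_⟩
    show chart (swap (c 0 - c 1) w) - chart c = flipSnd (chart w - chart c)
    funext j; fin_cases j <;> simp [chart, swap, flipSnd] <;> ring
  · have hm : (c 0 + c 1) % 2 = 1 := by omega
    refine ⟨(aswapIso (c 0 + c 1) hm).trans (invIso c hc), ?_, fun w => ?_⟩
    · show inv c (aswap (c 0 + c 1) c) = c
      funext i; fin_cases i <;> simp [inv, aswap] <;> ring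
    · show chart (inv c (aswap (c 0 + c 1) w)) - chart c = flipSnd (chart w - chart c)
      funext j; fin_cases j <;> simp [chart, inv, aswap, flipSnd] <;> ring

/-- **`flipFst` at every lattice point** (compose `flipSnd` with `−I`). [cite: KozmaNitzan2024, §4 p. 16 (Lemma 8)] -/
theorem exists_flipFst (c : Site 3) (hc : (c 0 + c 1 + c 2) % 2 = 0) :
    ∃ α : graph ≃g graph, α c = c ∧ ∀ w, chart (α w) - chart c = flipFst (chart w - chart c) := by
  obtain ⟨ρ, hρ, hφρ⟩ := exists_neg c hc
  obtain ⟨σ, hσ, hφσ⟩ := exists_flipSnd c hc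
  refine ⟨σ.trans ρ, ?_, fun w => ?_⟩
  · show ρ (σ c) = c; rw [hσ, hρ]
  · show chart (ρ (σ w)) - chart c = flipFst (chart w - chart c)
    rw [hφρ, hφσ, neg_flipSnd]

/-- Every site has even coordinate sum (so all three point symmetries sit at every site). [folklore] -/
theorem sum_even_of_mem_sites {c : Site 3} (hc : c ∈ sites) : (c 0 + c 1 + c 2) % 2 = 0 := by
  simp only [sites, Set.mem_setOf_eq] at hc; omega

/-! ## §4 QUASI-STEPS at scale `2`: each of `±2e₀, ±2e₁` is a single bond or a 2-path -/

/-- **Quasi-steps at the four base vertices** (16 explicit cases). [cite: KozmaNitzan2024, §4 p. 15 (outward steps)] -/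
theorem qstep_base (c : Fin 4) (j : Fin 2) (σ : ℤˣ) : ∃ y z : Site 3, graph.Adj (base c) y ∧ (z = y ∨ graph.Adj y z) ∧
    chart z = chart (base c) + Pi.single j (2 * (σ : ℤ)) := by
  fin_cases c <;> fin_cases j <;> rcases Int.units_eq_one_or σ with rfl | rfl
  -- base 0 = (0,0,0)
  · exact ⟨![1, 1, 0], ![1, 1, 0], adj_of _ _ (by decide) (by decide) (by decide), Or.inl rfl, by decide⟩
  · exact ⟨![-1, -1, 0], ![-1, -1, 0], adj_of _ _ (by decide) (by decide) (by decide), Or.inl rfl, by decide⟩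
  · exact ⟨![0, -1, -1], ![1, -1, -2], adj_of _ _ (by decide) (by decide) (by decide),
      Or.inr (adj_of _ _ (by decide) (by decide) (by decide)), by decide⟩
  · exact ⟨![-1, 0, -1], ![-1, 1, -2], adj_of _ _ (by decide) (by decide) (by decide),
      Or.inr (adj_of _ _ (by decide) (by decide) (by decide)), by decide⟩
  -- base 1 = (0,1,1)
  · exact ⟨![0, 2, 2], ![1, 2, 3], adj_of _ _ (by decide) (by decide) (by decide),
      Or.inr (adj_of _ _ (by decide) (by decide) (by decide)), by decide⟩
  · exact ⟨![-1, 1, 2], ![-1, 0, 3], adj_of _ _ (by decide) (by decide) (by decide),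
      Or.inr (adj_of _ _ (by decide) (by decide) (by decide)), by decide⟩
  · exact ⟨![1, 0, 1], ![1, 0, 1], adj_of _ _ (by decide) (by decide) (by decide), Or.inl rfl, by decide⟩
  · exact ⟨![-1, 2, 1], ![-1, 2, 1], adj_of _ _ (by decide) (by decide) (by decide), Or.inl rfl, by decide⟩
  -- base 2 = (1,0,1)
  · exact ⟨![1, 1, 0], ![2, 1, -1], adj_of _ _ (by decide) (by decide) (by decide),
      Or.inr (adj_of _ _ (by decide) (by decide) (by decide)), by decide⟩
  · exact ⟨![0, 0, 0], ![0, -1, -1], adj_of _ _ (by decide) (by decide) (by decide),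
      Or.inr (adj_of _ _ (by decide) (by decide) (by decide)), by decide⟩
  · exact ⟨![2, -1, 1], ![2, -1, 1], adj_of _ _ (by decide) (by decide) (by decide), Or.inl rfl, by decide⟩
  · exact ⟨![0, 1, 1], ![0, 1, 1], adj_of _ _ (by decide) (by decide) (by decide), Or.inl rfl, by decide⟩
  -- base 3 = (1,1,0)
  · exact ⟨![2, 2, 0], ![2, 2, 0], adj_of _ _ (by decide) (by decide) (by decide), Or.inl rfl, by decide⟩
  · exact ⟨![0, 0, 0], ![0, 0, 0], adj_of _ _ (by decide) (by decide) (by decide), Or.inl rfl, by decide⟩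
  · exact ⟨![1, 0, 1], ![2, 0, 2], adj_of _ _ (by decide) (by decide) (by decide),
      Or.inr (adj_of _ _ (by decide) (by decide) (by decide)), by decide⟩
  · exact ⟨![0, 1, 1], ![0, 2, 2], adj_of _ _ (by decide) (by decide) (by decide),
      Or.inr (adj_of _ _ (by decide) (by decide) (by decide)), by decide⟩

/-- **QUASI-STEPS AT EVERY SITE**: for every site `x`, direction `j` and sign `σ` there are `y, z` with `x ∼ y`, `z = y` or `y ∼ z`, and
`chart z = chart x + 2σ e_j` (transport of `qstep_base` by the frames). [cite: KozmaNitzan2024, §4 p. 15 (outward steps)] -/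
theorem qstep (x : Site 3) (hx : x ∈ sites) (j : Fin 2) (σ : ℤˣ) : ∃ y z : Site 3, graph.Adj x y ∧ (z = y ∨ graph.Adj y z) ∧
    chart z = chart x + Pi.single j (2 * (σ : ℤ)) := by
  obtain ⟨c, w, hw, hxe⟩ := exists_frame x hx
  obtain ⟨y, z, h1, h2, h3⟩ := qstep_base c j σ
  refine ⟨y + w, z + w, ?_, ?_, ?_⟩
  · have h := (shiftIso w hw).map_rel_iff.2 h1
    rwa [hxe, shiftIso_apply] at h
  · rcases h2 with rfl | h2
    · exact Or.inl rfl
    · exact Or.inr (by simpa using (shiftIso w hw).map_rel_iff.2 h2)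
  · rw [← hxe, shiftIso_apply, chart_add, chart_add, h3]; abel

end PyroZ3

end Summit.CriticalPhenomena.PercolationContinuityZ3.Theorems.Transplant

end
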